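import Literature.AlgebraicGeometry.AbelianSchemes.AbelianSchemeBaseQuotientHomDescent
import Literature.AlgebraicGeometry.AbelianSchemes.AbelianSchemeOverLevelBaseChange
import Literature.AlgebraicGeometry.RelativeSpec.GeometricQuotientFreeFlat
import Literature.AlgebraicGeometry.Morphisms.GeometricPointsLiftSurjective
import HarnessLib

/-!
# A level structure descends along a free finite quotient OF THE BASE
# ([MFK94] Ch. 7 §2 Def. 7.2, §3 Lemma 7.11; SGA 1 VIII 7.8 — finite-group form)

Topic `AlgebraicGeometry/AbelianSchemes`; namespace `Literature.AlgebraicGeometry.AbelianSchemes.AbelianSchemeOver`.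
THEOREMS ONLY (no definition, no named fact, no instance, no notation, no `sorry`; net Literature debt 0).
Cell hodgecm-mathlib (D-0151), F-DAG price sheet leaf F-10 (10a), third instalment (after ★ `AbelianSchemeBaseQuotientDescent`
— the abelian scheme and its law descend — and ★ `AbelianSchemeBaseQuotientHomDescent` — homomorphisms and sections
descend).  HC_CM is proved only modulo the 7 printed citations until rung 0 closes; this file discharges none of them
(count-neutral capital).

SETTING.  `p : S → Q` an affine geometric quotient by a FREE action `ρ` of the finite group `G` on the base (ring-form
freeness); `B` an abelian scheme over `Q` (total space separated) and `B ×_Q S` its chosen base change (★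
`AbelianSchemeOver.baseChange`), on which `G` acts through the second factor (`𝟙 ×_Q ρ(g)`).

* `sectionBaseChange_injective_of_epi` — pulling sections back along an epimorphism `p` is injective.
* `LevelStructure.exists_desc_of_free_base_quotient` — a level-`n` structure `φ′` on `B ×_Q S` whose sections are
  `G`-EQUIVARIANT descends: there is a level-`n` structure `ψ` on `B` with `φ′.σᵢ = ψ.σᵢ ×_Q S` for all `i` (so
  `φ′` and `ψ.baseChange p` have the same sections).  Sections descend by ★ `exists_section_desc_of_free_base_quotient`;
  torsion descends by injectivity of the pull-back of sections; the basis conditions on a geometric fibre of `B` over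
  `t : Spec Ω → Q` are those of `φ′` over a LIFT `s : Spec Ω → S` of `t` (★ `Morphisms.exists_comp_eq_of_surjective`,
  `p` surjective and étale), through ★ `fibrePointsBaseChangeEquiv : B_{s ≫ p}(Ω) ≃* (B ×_Q S)_s(Ω)`.

Mathlib searched (pin): `MonoidHom.map_pow`, `MulEquiv.injective`, `Function.Injective` (all used); no quotients of
schemes by finite groups in Mathlib.

## References
* D. Mumford, J. Fogarty, F. Kirwan, *Geometric Invariant Theory*, 3rd ed. (1994), Ch. 7 §2 Definitions 7.1–7.2
  (p. 129); §3, Lemma 7.11 (p. 140). [MumfordFogartyKirwan1994]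
* A. Grothendieck, *SGA 1*, Exp. VIII Cor. 7.8; Exp. V Prop. 2.6, Déf. 2.7. [SGA1]
-/

noncomputable section

universe u

open CategoryTheory Limits AlgebraicGeometry MonoidalCategory CartesianMonoidalCategory MonObj

namespace Literature.AlgebraicGeometry.AbelianSchemes.AbelianSchemeOver

open Literature.AlgebraicGeometry.RelativeSpec Literature.AlgebraicGeometry.RelativeSpec.ActionOver

set_option backward.isDefEq.respectTransparency false

/-! ### §1 Pulling sections back along an epimorphism is injective -/

/-- **Pull-back of sections along an epimorphism of schemes is injective**: `σ ×_S S'` determines `σ` when `g : S' → S`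
is an epimorphism (`(σ ×_S S') ≫ pr₁ = g ≫ σ`, ★ `sectionBaseChange_left_comp_fst`).
[cite: MumfordFogartyKirwan1994, Ch. 7 §2 Definition 7.2 (p. 129)] -/
theorem sectionBaseChange_injective_of_epi {S S' : Scheme.{u}} (A : AbelianSchemeOver S) (g : S' ⟶ S) [Epi g] :
    Function.Injective (A.sectionBaseChange g) := by
  intro x y h
  apply Over.OverMorphism.ext
  rw [← cancel_epi g, ← sectionBaseChange_left_comp_fst, ← sectionBaseChange_left_comp_fst, h]

/-! ### §2 Level structures descend -/

variable {S Q : Scheme.{u}} {p : S ⟶ Q} {G : Type u} [Group G] [Fintype G] {ρ : ActionOver p G}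
  (hq : ρ.IsGeometricQuotient p) [IsAffineHom p]
  (hfree : ∀ (V : Q.Opens), IsAffineOpen V → ∀ g : G, g ≠ 1 →
    Ideal.span (Set.range fun s : Γ(S, p ⁻¹ᵁ V) ↦ ρ.act g V s - s) = ⊤)
  (B : AbelianSchemeOver Q) [B.X.left.IsSeparated] {g₀ n : ℕ}

include hq hfree in
/-- **A LEVEL STRUCTURE WITH EQUIVARIANT SECTIONS DESCENDS ALONG A FREE FINITE QUOTIENT OF THE BASE.**  In the SETTING
of the module docstring: a level-`n` structure `φ′` on `B ×_Q S` whose sections `σᵢ : S → B ×_Q S` satisfy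
`ρ(g) ≫ σᵢ = σᵢ ≫ (𝟙 ×_Q ρ(g))` for all `g` is the pull-back of a level-`n` structure `ψ` on `B`: `φ′.σᵢ = ψ.σᵢ ×_Q S`.
[cite: MumfordFogartyKirwan1994, Ch. 7 §2 Definitions 7.1–7.2 (p. 129) and §3 Lemma 7.11 (p. 140)]
[cite: SGA1, Exp. VIII Cor. 7.8] -/
theorem LevelStructure.exists_desc_of_free_base_quotient (φ' : LevelStructure g₀ n (B.baseChange p))
    (hφ' : ∀ (g : G) (i : Fin g₀ ⊕ Fin g₀), (ρ.aut g).hom ≫ (φ'.σ i).left =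
      (φ'.σ i).left ≫ pullback.map B.X.hom p B.X.hom p (𝟙 B.X.left) (ρ.aut g).hom (𝟙 Q)
        (by rw [Category.id_comp, Category.comp_id]) (by rw [ρ.aut_comp, Category.comp_id])) :
    ∃ ψ : LevelStructure g₀ n B, ∀ i, B.sectionBaseChange p (ψ.σ i) = φ'.σ i := by
  -- `p` is a finite étale epimorphism
  haveI : Flat p := hq.flat_of_free hfree
  haveI : Surjective p := ⟨hq.surjective⟩
  haveI : Epi p := Flat.epi_of_flat_of_surjective p
  haveI : Etale p := hq.etale_of_free hfree
  -- the action of `G` on `B ×_Q S` through the second factor, over `pr₁`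
  have h₁ : ∀ g : G, ((1 : G →* Aut B.X.left) g).hom ≫ B.X.hom = B.X.hom ≫ ((1 : G →* Aut Q) g).hom := fun g => by
    rw [MonoidHom.one_apply, MonoidHom.one_apply]; exact (Category.id_comp _).trans (Category.comp_id _).symm
  have h₂ : ∀ g : G, (ρ.aut g).hom ≫ p = p ≫ ((1 : G →* Aut Q) g).hom := fun g => by
    rw [MonoidHom.one_apply, ρ.aut_comp]; exact (Category.comp_id _).symm
  have hr : ∀ g : G, (ActionOver.pullbackMapHom B.X.hom p 1 ρ.aut 1 h₁ h₂ g).hom ≫ pullback.fst B.X.hom p =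
      pullback.fst B.X.hom p := fun g => by
    rw [ActionOver.pullbackMapHom_hom_fst, MonoidHom.one_apply]; exact Category.comp_id _
  let ρA : ActionOver (pullback.fst B.X.hom p) G := ActionOver.onPullback B.X.hom p 1 ρ.aut 1 h₁ h₂ _ hr
  have hbc : (B.baseChange p).IsBaseChangeVia B p (pullback.fst B.X.hom p) := B.baseChange_isBaseChangeVia p
  -- the sections descend
  have hτ : ∀ i, ∃ τ : B.Sections, (φ'.σ i).left ≫ pullback.fst B.X.hom p = p ≫ τ.left := fun i =>
    exists_section_desc_of_free_base_quotient hq hfree hbc ρA (φ'.σ i) fun g => hφ' g i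
  choose τ hτ using hτ
  have hστ : ∀ i, B.sectionBaseChange p (τ i) = φ'.σ i := fun i => by
    apply Over.OverMorphism.ext
    apply pullback.hom_ext
    · rw [sectionBaseChange_left_comp_fst, ← hτ]
    · exact (Over.w (B.sectionBaseChange p (τ i))).trans (Over.w (φ'.σ i)).symm
  have hστ' : (fun i => B.sectionBaseChange p (τ i)) = φ'.σ := funext hστ
  have hinj := B.sectionBaseChange_injective_of_epi p
  refine ⟨{ σ := τ, pow_σ := fun i => ?_, basis_injective := ?_, basis_surjective := ?_ }, hστ⟩
  · -- torsion
    apply hinj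
    rw [map_pow, hστ, φ'.pow_σ, map_one]
  · -- basis: injectivity on a geometric fibre over `t = s ≫ p`
    intro Ω _ _ t
    obtain ⟨s, rfl⟩ := Literature.AlgebraicGeometry.Morphisms.exists_comp_eq_of_surjective p t
    intro a b hab
    have hab' : B.fibrePointsBaseChangeEquiv p s (B.restrict (s ≫ p) (B.sectionPow τ a)) =
        B.fibrePointsBaseChangeEquiv p s (B.restrict (s ≫ p) (B.sectionPow τ b)) := by
      have := hab
      simp only at this
      rw [this]
    rw [← restrict_sectionBaseChange, ← restrict_sectionBaseChange, sectionBaseChange_sectionPow,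
      sectionBaseChange_sectionPow, hστ'] at hab'
    exact φ'.basis_injective s hab'
  · -- basis: surjectivity on a geometric fibre over `t = s ≫ p`
    intro Ω _ _ t
    obtain ⟨s, rfl⟩ := Literature.AlgebraicGeometry.Morphisms.exists_comp_eq_of_surjective p t
    intro x hx
    obtain ⟨a, ha⟩ := φ'.basis_surjective s (B.fibrePointsBaseChangeEquiv p s x) (by rw [← map_pow, hx, map_one])
    refine ⟨a, (B.fibrePointsBaseChangeEquiv p s).injective ?_⟩
    rw [← restrict_sectionBaseChange, sectionBaseChange_sectionPow, hστ', ha]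

end Literature.AlgebraicGeometry.AbelianSchemes.AbelianSchemeOver

end
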